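import Mathlib.Algebra.Order.Field.Basic
import Mathlib.Tactic.Ring
import Mathlib.Tactic.Linarith
import Mathlib.Tactic.LinearCombination
import Mathlib.Tactic.FieldSimp
import Mathlib.Tactic.Positivity
import Summits.Ventures.CertifiedArithmetic.LowPrec.SREnvelopes
import Summits.Ventures.CertifiedArithmetic.LowPrec.SRRecursion
import HarnessLib

/-!
# Stochastic rounding into a finite format: affine RECURSIONS, II — exact variance, stationary bound

HONEST FRAMING: certified error envelopes and provably optimal rounding/accumulation schemes for
low-precision formats under stated cost models; every table by two implementations; no hardware or
vendor claims.

File 2 of 3 on recursions `xₖ₊₁ = SR_F(a k · xₖ + b k)` (EMA / momentum / axpy / product chains), on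
top of `SRRecursion` (the mean theorems). Here: the second moment.

* `step_sq_linear` — one step: `E[(A·SR(c) + B)²] = A²·v_F(c̄) + (A·c̄ + B)²`;
* `recVar F a b n s = ∑ₖ A_{k+1}² · E[v_F(clamp cₖ)]` — the conditional variances enter with their
  squared DOWNSTREAM GAINS `A_{k+1} = ∏_{j>k} a j`; `sqGainSum a n = ∑ₖ A_{k+1}²`;
* `recExp_affMap_sq_sub` — **EXACT VARIANCE IDENTITY** (no saturation): for every centre `e`,
  `E[(xₙ − e)²] = recVar + (mₙ − e)²`; in particular `Var[xₙ] = recVar` (`recExp_affMap_var`) —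
  orthogonality of the mean-independent increments, finite-format exact;
* `recVar_le_window` — `Var[xₙ] ≤ (∑ₖ A_{k+1}²)·G²/4` when every pre-rounding value on every branch
  has candidate gap `≤ G` (`a ≡ 1`: file III's `n·G²/4`);
* `recVar_le_geom`, `recVar_le_stationary` — for CONTRACTIONS `|a k| ≤ β`, `β² < 1`:
  `Var[xₙ] ≤ (1 − β²ⁿ)/(1 − β²)·G²/4 ≤ G²/(4(1 − β²))` for EVERY `n`. This is the fixed-point
  filter designer's roundoff-noise gain `σ₀²/(1 − a²)` ([Jackson1996] §11.2, there derived from the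
  white-noise ASSUMPTION "supported by experimental evidence") as a THEOREM with exact hypotheses:
  no independence or whiteness is assumed — mean independence of saturating SR suffices; the
  SR-EMA / momentum jitter has standard deviation `≤ G/(2√(1−β²))` uniformly in time, to be compared
  with the round-to-nearest dead band of half-width up to `G/(2(1−β))` (file 3);
* `rec_prob_dev_ge_le` — Chebyshev: `P(|xₙ − mₙ| ≥ t) ≤ recVar/t²`.

References: [ArarEtAl2023] §3 (variance approach, `V ≤ ε²/4`); [ConnollyHighamMary2021] Lemma 4.5;
[CrociGiles2022] §4.2 (mean-square global rounding error of SR time-stepping `≤ ε² ∑ 1/(1 − S²)`, the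
continuous-model analogue of `recVar_le_stationary`); [Jackson1996] §11.2, §11.5.
-/

namespace Summit.Ventures.CertifiedArithmetic.LowPrec.SR

open Literature.ComputerArithmetic.ConnollyHighamMary2021
open Finset

variable {K : Type*} [Field K] [LinearOrder K] [IsStrictOrderedRing K]

/-! ### The variance functional and its weights -/

/-- Sum of squared downstream gains `∑_{k<n} (∏_{k<j<n} a j)²` — the variance weight. -/
def sqGainSum (a : ℕ → K) : ℕ → K
  | 0 => 0
  | n + 1 => affGain (fun i => a (i + 1)) n ^ 2 + sqGainSum (fun i => a (i + 1)) n


/-- Accumulated gain-weighted variance `∑ₖ A_{k+1}² E[v_F(clamp cₖ)]`. -/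
def recVar (F : Finset K) : (ℕ → K) → (ℕ → K) → ℕ → K → K
  | _, _, 0, _ => 0
  | a, b, n + 1, s => affGain (fun i => a (i + 1)) n ^ 2 * srVar F (clamp F (a 0 * s + b 0))
      + step F (a 0 * s + b 0) (recVar F (fun i => a (i + 1)) (fun i => b (i + 1)) n)


/-- `E[(A·SR(c) + B)²] = A²·v_F(clamp c) + (A·clamp c + B)²` — the one-step second moment of an
affine functional splits into gain² × conditional variance plus the squared mean. -/
theorem step_sq_linear (F : Finset K) (c A B : K) :
    step F c (fun t => (A * t + B) ^ 2) = A ^ 2 * srVar F (clamp F c) + (A * clamp F c + B) ^ 2 := by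
  have hm : probUp F (clamp F c) * roundUp F (clamp F c)
      + (1 - probUp F (clamp F c)) * roundDown F (clamp F c) = clamp F c := srMean_eq_self F _
  unfold step srVar pUp up dn
  linear_combination (2 * A * B + 2 * A ^ 2 * clamp F c) * hm


/-! ### Variance: the exact identity -/

/-- **Exact variance identity for affine recursions.** Without saturation, for every centre `e`,
`E[(xₙ − e)²] = recVar + (mₙ − e)²`: the mean-independent increments are orthogonal and enter with
their squared downstream gains. -/
theorem recExp_affMap_sq_sub (F : Finset K) (a b : ℕ → K) (n : ℕ) (s : K)
    (h : NoSatR F (affMap a b) n s) (e : K) :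
    recExp F (affMap a b) n (fun t => (t - e) ^ 2) s = recVar F a b n s + (affMean a b n s - e) ^ 2 := by
  induction n generalizing a b s e with
  | zero => simp [recExp, recVar, affMean]
  | succ n ih =>
      obtain ⟨hc, hu, hd⟩ := h
      simp only [affMap_succ, affMap_apply] at hc hu hd
      simp only [recExp, affMap_succ, recVar, affMean, affMap_apply]
      have key : step F (a 0 * s + b 0)
            (recExp F (affMap (fun i => a (i + 1)) (fun i => b (i + 1))) n fun t => (t - e) ^ 2)
          = step F (a 0 * s + b 0) (recVar F (fun i => a (i + 1)) (fun i => b (i + 1)) n)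
            + step F (a 0 * s + b 0) (fun t => (affGain (fun i => a (i + 1)) n * t
              + (affMean (fun i => a (i + 1)) (fun i => b (i + 1)) n 0 - e)) ^ 2) := by
        rw [← step_add]
        refine step_congr F _ ?_ ?_
        · rw [ih _ _ _ hu, affMean_eq]; ring
        · rw [ih _ _ _ hd, affMean_eq]; ring
      rw [key, step_sq_linear, clamp_eq_self hc,
        affMean_eq (fun i => a (i + 1)) (fun i => b (i + 1)) n (a 0 * s + b 0)]
      ring

/-- The variance about the exact trajectory: `Var[xₙ] = recVar`. -/
theorem recExp_affMap_var (F : Finset K) (a b : ℕ → K) (n : ℕ) (s : K)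
    (h : NoSatR F (affMap a b) n s) :
    recExp F (affMap a b) n (fun t => (t - affMean a b n s) ^ 2) s = recVar F a b n s := by
  rw [recExp_affMap_sq_sub F a b n s h, sub_self, zero_pow two_ne_zero, add_zero]

/-! ### Variance envelopes: window bound and the stationary bound for contractions -/

/-- The accumulated variance is nonnegative. -/
theorem recVar_nonneg (F : Finset K) (a b : ℕ → K) (n : ℕ) (s : K) : 0 ≤ recVar F a b n s := by
  induction n generalizing a b s with
  | zero => exact le_rfl
  | succ n ih =>
      simp only [recVar]
      refine add_nonneg (mul_nonneg (sq_nonneg _) (srVar_nonneg F _)) ?_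
      have := step_mono F (a 0 * s + b 0) (f := fun _ => (0 : K))
        (g := recVar F (fun i => a (i + 1)) (fun i => b (i + 1)) n) (fun t => ih _ _ t)
      rwa [step_const] at this

/-- **Window envelope.** If every pre-rounding value on every branch has candidate gap `≤ G`, then
`recVar ≤ (∑ₖ Aₖ²)·G²/4`. For `a ≡ 1` (sums, axpy) this is file III's `n·G²/4`. -/
theorem recVar_le_window (F : Finset K) (G : K) (a b : ℕ → K) (n : ℕ) (s : K)
    (h : GapLER F G (affMap a b) n s) : recVar F a b n s ≤ sqGainSum a n * (G ^ 2 / 4) := by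
  induction n generalizing a b s with
  | zero => simp [recVar, sqGainSum]
  | succ n ih =>
      obtain ⟨hg, hu, hd⟩ := h
      simp only [affMap_succ, affMap_apply] at hg hu hd
      simp only [recVar, sqGainSum]
      have h1 : srVar F (clamp F (a 0 * s + b 0)) ≤ G ^ 2 / 4 := by
        refine (srVar_le_gap_sq_div_four F _).trans ?_
        have h0 : 0 ≤ roundUp F (clamp F (a 0 * s + b 0)) - roundDown F (clamp F (a 0 * s + b 0)) :=
          sub_nonneg.mpr (roundDown_le_roundUp F _)
        have := mul_self_le_mul_self h0 hg
        nlinarith [this]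
      have h2 : step F (a 0 * s + b 0) (recVar F (fun i => a (i + 1)) (fun i => b (i + 1)) n)
          ≤ sqGainSum (fun i => a (i + 1)) n * (G ^ 2 / 4) :=
        step_le_of F _ (ih _ _ _ hu) (ih _ _ _ hd)
      have h3 : 0 ≤ affGain (fun i => a (i + 1)) n ^ 2 := sq_nonneg _
      nlinarith [mul_le_mul_of_nonneg_left h1 h3]

/-- Squared gain of a contraction: `|a k| ≤ β ⇒ (∏_{k<n} a k)² ≤ (β²)ⁿ`. -/
theorem affGain_sq_le (a : ℕ → K) {β : K} (hβ : ∀ k, |a k| ≤ β) (n : ℕ) :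
    affGain a n ^ 2 ≤ (β ^ 2) ^ n := by
  induction n generalizing a with
  | zero => simp [affGain]
  | succ n ih =>
      simp only [affGain]
      have h0 := ih (fun i => a (i + 1)) (fun k => hβ (k + 1))
      have h1 : a 0 ^ 2 ≤ β ^ 2 := by
        have := hβ 0
        rw [abs_le] at this
        exact sq_le_sq' this.1 this.2
      rw [mul_pow, pow_succ (β ^ 2) n]
      exact mul_le_mul h0 h1 (sq_nonneg _) (pow_nonneg (sq_nonneg _) _)

/-- Geometric control of the variance weight for contractions:
`(1 − β²)·∑ₖ Aₖ² ≤ 1 − (β²)ⁿ`. -/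
theorem sqGainSum_contract (a : ℕ → K) {β : K} (hβ : ∀ k, |a k| ≤ β) (hβ1 : β ^ 2 ≤ 1) (n : ℕ) :
    (1 - β ^ 2) * sqGainSum a n ≤ 1 - (β ^ 2) ^ n := by
  induction n generalizing a with
  | zero => simp [sqGainSum]
  | succ n ih =>
      simp only [sqGainSum]
      have h0 := ih (fun i => a (i + 1)) (fun k => hβ (k + 1))
      have h1 := affGain_sq_le (fun i => a (i + 1)) (fun k => hβ (k + 1)) n
      have h2 : 0 ≤ 1 - β ^ 2 := sub_nonneg.mpr hβ1
      rw [pow_succ (β ^ 2) n]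
      nlinarith [mul_le_mul_of_nonneg_left h1 h2]

/-- **Transient bound for contracting recursions** (`|a k| ≤ β`, `β² < 1`), under `GapLER G`:
`Var[xₙ] ≤ (1 − β²ⁿ)/(1 − β²) · G²/4`. -/
theorem recVar_le_geom (F : Finset K) (G : K) (a b : ℕ → K) {β : K} (hβ : ∀ k, |a k| ≤ β)
    (hβ1 : β ^ 2 < 1) (n : ℕ) (s : K) (h : GapLER F G (affMap a b) n s) :
    recVar F a b n s ≤ (1 - (β ^ 2) ^ n) / (1 - β ^ 2) * (G ^ 2 / 4) := by
  have hd : 0 < 1 - β ^ 2 := sub_pos.mpr hβ1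
  have hS : sqGainSum a n ≤ (1 - (β ^ 2) ^ n) / (1 - β ^ 2) := by
    rw [le_div_iff₀ hd]
    have := sqGainSum_contract a hβ hβ1.le n
    linarith
  exact (recVar_le_window F G a b n s h).trans (mul_le_mul_of_nonneg_right hS (by positivity))

/-- **STATIONARY bound for contracting recursions** (`|a k| ≤ β`, `β² < 1`), under `GapLER G`:
`Var[xₙ] ≤ G²/(4(1 − β²))` for EVERY `n` — the SR-EMA/momentum jitter has standard deviation at most
`G/(2√(1−β²))`, uniformly in time. -/
theorem recVar_le_stationary (F : Finset K) (G : K) (a b : ℕ → K) {β : K} (hβ : ∀ k, |a k| ≤ β)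
    (hβ1 : β ^ 2 < 1) (n : ℕ) (s : K) (h : GapLER F G (affMap a b) n s) :
    recVar F a b n s ≤ G ^ 2 / (4 * (1 - β ^ 2)) := by
  have hd : 0 < 1 - β ^ 2 := sub_pos.mpr hβ1
  have hS : sqGainSum a n ≤ 1 / (1 - β ^ 2) := by
    rw [le_div_iff₀ hd]
    have := sqGainSum_contract a hβ hβ1.le n
    have hp : 0 ≤ (β ^ 2) ^ n := pow_nonneg (sq_nonneg _) _
    linarith
  calc recVar F a b n s ≤ sqGainSum a n * (G ^ 2 / 4) := recVar_le_window F G a b n s h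
    _ ≤ 1 / (1 - β ^ 2) * (G ^ 2 / 4) := mul_le_mul_of_nonneg_right hS (by positivity)
    _ = G ^ 2 / (4 * (1 - β ^ 2)) := by
        field_simp

/-- The same two bounds for the variance itself (`E[(xₙ − mₙ)²]`), with the no-saturation
hypothesis that identifies it with `recVar`. -/
theorem recExp_affMap_var_le_stationary (F : Finset K) (G : K) (a b : ℕ → K) {β : K}
    (hβ : ∀ k, |a k| ≤ β) (hβ1 : β ^ 2 < 1) (n : ℕ) (s : K) (hN : NoSatR F (affMap a b) n s)
    (hG : GapLER F G (affMap a b) n s) :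
    recExp F (affMap a b) n (fun t => (t - affMean a b n s) ^ 2) s ≤ G ^ 2 / (4 * (1 - β ^ 2)) := by
  rw [recExp_affMap_var F a b n s hN]
  exact recVar_le_stationary F G a b hβ hβ1 n s hG

/-- Chebyshev form: `P(|xₙ − mₙ| ≥ t) ≤ recVar / t²` (no saturation). -/
theorem rec_prob_dev_ge_le (F : Finset K) (a b : ℕ → K) (n : ℕ) (s : K)
    (h : NoSatR F (affMap a b) n s) {t : K} (ht : 0 < t) :
    recExp F (affMap a b) n (devInd t (affMean a b n s)) s ≤ recVar F a b n s / t ^ 2 := by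
  have h1 : recExp F (affMap a b) n (devInd t (affMean a b n s)) s
      ≤ recExp F (affMap a b) n (fun v => (v - affMean a b n s) ^ 2 / t ^ 2) s :=
    recExp_mono F _ n (fun v => devInd_le_sq_div t _ v ht) s
  have h2 : recExp F (affMap a b) n (fun v => (v - affMean a b n s) ^ 2 / t ^ 2) s
      = recVar F a b n s / t ^ 2 := by
    have e : (fun v => (v - affMean a b n s) ^ 2 / t ^ 2)
        = fun v => (1 / t ^ 2) * (v - affMean a b n s) ^ 2 := by
      funext v; ring
    rw [e, recExp_mul_left, recExp_affMap_var F a b n s h]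
    ring
  linarith

end Summit.Ventures.CertifiedArithmetic.LowPrec.SR
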